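import Literature.AlgebraicTopology.FundamentalGroup.PuncturedTorusSlitTori
import Literature.AlgebraicTopology.FundamentalGroup.FreeGroupPuncturedPlane
import Literature.AlgebraicTopology.FundamentalGroup.CircleAndTorus
import Literature.AlgebraicTopology.FundamentalGroup.DeformationRetractInclusion
import HarnessLib

/-!
# The fundamental group of the once-punctured torus is free of rank two

Topic `Literature/AlgebraicTopology/FundamentalGroup`.  For the real torus `T = (ℝ/ℤ)^ι` with EXACTLY
two indices `i₀ ≠ i₁` (the tree's model `ι → AddCircle 1`; as a space the tree's `ComplexTorus`, so
this is the topological type of a once-punctured elliptic curve over `ℂ`) and any point `x₀ ∈ T`: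

> **`π₁(T ∖ {x₀}, y) ≅ F₂`** for every base point `y` — `nonempty_mulEquiv_freeGroup_puncturedTorus`

(A. Hatcher, *Algebraic Topology* (2002), §1.2 Example 1.22: the once-punctured torus deformation
retracts onto the figure eight, whose fundamental group is free of rank two by van Kampen's theorem,
Thm. 1.20.)  PROOF (van Kampen applied directly to the punctured torus): `T ∖ {x₀}` is the union of
the open slit tori `U = {p | p i₁ ≠ x₀ i₁}` and `V = {p | p i₀ ≠ x₀ i₀}`, path connected and each of
fundamental group `ℤ ≅ F₁` (`nonempty_mulEquiv_freeGroup_coordNe`: it slides onto the opposite edge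
circle `≅ ℝ/ℤ`, `PuncturedTorusSlitTori.isStrongDeformationRetractOf_coordSlide` + Hatcher Prop. 1.17
+ Thm. 1.7, the tree's `fundamentalGroupAddCircleEquiv`), meeting in the open square
`{p | ∀ i, p i ≠ x₀ i}`, which is simply connected (`isSimplyConnected_forall_ne`); the tree's
free-product form of van Kampen (`VanKampen.fundamentalGroupEquivCoprod`) gives
`π₁ ≅ F₁ ∗ F₁ ≅ F₂` (`freeGroupSumMulEquivCoprod`), and the base point is moved along a path
(`isPathConnected_compl_singleton_torus`).

Also `pathConnectedSpace_compl_singleton_torus` — the consumer shape of the abc-iut cell's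
campaign-L R1 capstone («`Cov^fin` of a once-punctured complex torus is id-rigid», with
`Literature.GroupTheory.isSlimGroup_profiniteCompletion_of_mulEquiv_freeGroup`, n = 2).
Proof-only: no definitions (the two auxiliary homeomorphisms are built inside the proofs).

## References
* A. Hatcher, *Algebraic Topology*, CUP (2002), §1.1 Thm. 1.7, Prop. 1.17; §1.2 Thm. 1.20,
  Example 1.22 (p. 51). [HatcherAT2002]
-/

noncomputable section

open Set Function
open scoped Topology

namespace Literature.AlgebraicTopology.FundamentalGroup

namespace PuncturedTorus

variable {ι : Type*} [DecidableEq ι] {i₀ i₁ : ι}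

/-! ### §1 The punctured torus is path connected -/

/-- **The punctured torus `T ∖ {x₀}` is path connected** (two indices): it is the union of the two
path connected slit tori, which meet. [cite: HatcherAT2002, §1.2 Example 1.22] -/
theorem isPathConnected_compl_singleton_torus (hι : ∀ i, i = i₀ ∨ i = i₁)
    (x₀ : ι → AddCircle (1 : ℝ)) : IsPathConnected ({x₀}ᶜ : Set (ι → AddCircle (1 : ℝ))) := by
  have hcov : ({x₀}ᶜ : Set (ι → AddCircle (1 : ℝ))) =
      {p | p i₀ ≠ x₀ i₀} ∪ {p | p i₁ ≠ x₀ i₁} := by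
    ext p
    simp only [mem_compl_iff, mem_singleton_iff, mem_union, mem_setOf_eq]
    constructor
    · intro hp
      by_cases h0 : p i₀ = x₀ i₀
      · right
        intro h1
        exact hp (funext fun i ↦ by rcases hι i with rfl | rfl <;> assumption)
      · exact Or.inl h0
    · rintro (h | h) hp <;> exact h (by rw [hp])
  rw [hcov]
  refine (isPathConnected_coordNe x₀ i₀).union (isPathConnected_coordNe x₀ i₁) ?_
  refine ⟨fun i ↦ x₀ i + ((2⁻¹ : ℝ) : AddCircle (1 : ℝ)), ?_, ?_⟩ <;>
  · intro h
    exact half_ne_zero (add_eq_left.1 h)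

/-- The punctured torus as a path connected SPACE. [cite: HatcherAT2002, §1.2 Example 1.22] -/
theorem pathConnectedSpace_compl_singleton_torus (hι : ∀ i, i = i₀ ∨ i = i₁)
    (x₀ : ι → AddCircle (1 : ℝ)) : PathConnectedSpace ({x₀}ᶜ : Set (ι → AddCircle (1 : ℝ))) :=
  isPathConnected_iff_pathConnectedSpace.1 (isPathConnected_compl_singleton_torus hι x₀)

/-! ### §2 The fundamental group of a slit torus is infinite cyclic -/

/-- **`π₁` of the slit torus `{p | p i₁ ≠ x₀ i₁}` is `F₁ ≅ ℤ`** (two indices), at a base point `w` of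
the edge circle `{p | p i₁ = x₀ i₁ + ½}`: the slide retraction onto that circle is a `π₁`-isomorphism
(Hatcher Prop. 1.17), the circle is homeomorphic to `ℝ/ℤ` by the `i₀`-th coordinate, and
`π₁(ℝ/ℤ) ≅ ℤ ≅ F₁` (Thm. 1.7). [cite: HatcherAT2002, Prop. 1.17; Thm. 1.7] -/
theorem nonempty_mulEquiv_freeGroup_coordNe (hne : i₀ ≠ i₁) (hι : ∀ i, i = i₀ ∨ i = i₁)
    (x₀ : ι → AddCircle (1 : ℝ)) {w : ι → AddCircle (1 : ℝ)}
    (hw : w i₁ - x₀ i₁ = ((2⁻¹ : ℝ) : AddCircle (1 : ℝ))) (hwS : w i₁ ≠ x₀ i₁) :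
    Nonempty (_root_.FundamentalGroup ({p : ι → AddCircle (1 : ℝ) | p i₁ ≠ x₀ i₁}) ⟨w, hwS⟩ ≃*
      FreeGroup (Fin 1)) := by
  set C : Set (ι → AddCircle (1 : ℝ)) := {p | p i₁ - x₀ i₁ = ((2⁻¹ : ℝ) : AddCircle (1 : ℝ))} with hC
  set S : Set (ι → AddCircle (1 : ℝ)) := {p | p i₁ ≠ x₀ i₁} with hS
  have hCS : C ⊆ S := by
    intro p hp h
    apply half_ne_zero
    rw [← (show p i₁ - x₀ i₁ = _ from hp), h, sub_self]
  have hwC : w ∈ C := hw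
  -- (1) the slide retraction: `π₁(C, w) ≅ π₁(S, w)`
  have hbij := VanKampen.bijective_inclHomOfSubset_of_isStrongDeformationRetractOf
    (isStrongDeformationRetractOf_coordSlide x₀ i₁) hCS hwC
  let e₁ : _root_.FundamentalGroup C ⟨w, hwC⟩ ≃* _root_.FundamentalGroup S ⟨w, hCS hwC⟩ :=
    MulEquiv.ofBijective _ hbij
  -- (2) the circle `C` is homeomorphic to `ℝ/ℤ` by the `i₀`-th coordinate
  have hmemC : ∀ y : AddCircle (1 : ℝ), Function.update w i₀ y ∈ C := by
    intro y
    show Function.update w i₀ y i₁ - x₀ i₁ = _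
    rw [Function.update_of_ne hne.symm]; exact hw
  have hcinv : Continuous fun y : AddCircle (1 : ℝ) ↦ Function.update w i₀ y := by fun_prop
  let e₂ : C ≃ₜ AddCircle (1 : ℝ) :=
    { toFun := fun p ↦ (p : ι → AddCircle (1 : ℝ)) i₀
      invFun := fun y ↦ ⟨Function.update w i₀ y, hmemC y⟩
      left_inv := by
        intro p
        apply Subtype.ext
        funext i
        change Function.update w i₀ ((p : ι → AddCircle (1 : ℝ)) i₀) i = (p : ι → AddCircle (1 : ℝ)) i
        rcases hι i with rfl | rfl
        · simp
        · rw [Function.update_of_ne hne.symm]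
          have hp : (p : ι → AddCircle (1 : ℝ)) i - x₀ i = _ := p.2
          exact sub_left_injective (hw.trans hp.symm)
      right_inv := fun y ↦ by simp
      continuous_toFun := (continuous_apply i₀).comp continuous_subtype_val
      continuous_invFun := hcinv.subtype_mk _ }
  have he₂ : e₂ ⟨w, hwC⟩ = w i₀ := rfl
  let e₃ := fundamentalGroupEquivOfHomeomorph e₂ he₂
  -- (3) `π₁(ℝ/ℤ) ≅ ℤ ≅ F₁`
  let e₄ := fundamentalGroupAddCircleEquiv (p := (1 : ℝ)) one_ne_zero (w i₀)
  let e₅ := (freeGroupUniqueMulEquivInt (Fin 1)).symm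
  exact ⟨e₁.symm.trans (e₃.trans (e₄.trans e₅))⟩

/-! ### §3 Van Kampen: `π₁(T ∖ {x₀}) ≅ F₁ ∗ F₁ ≅ F₂` -/

/-- **The fundamental group of the once-punctured torus is free of rank two** (Hatcher, Example 1.22
with Thm. 1.20): for `T = (ℝ/ℤ)^ι` with exactly two indices `i₀ ≠ i₁`, every `x₀ ∈ T` and every base
point `y ∈ T ∖ {x₀}`, `π₁(T ∖ {x₀}, y) ≅ F₂ = FreeGroup (Fin 2)`.  Van Kampen for the cover of
`T ∖ {x₀}` by the two slit tori `{p | p i₁ ≠ x₀ i₁}`, `{p | p i₀ ≠ x₀ i₀}` (each of `π₁ ≅ F₁`,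
`nonempty_mulEquiv_freeGroup_coordNe`) meeting in the simply connected open square
(`isSimplyConnected_forall_ne`), then `F₁ ∗ F₁ ≅ F₂` and a change of base point.
[cite: HatcherAT2002, §1.2 Example 1.22 (p. 51); Thm. 1.20] -/
theorem nonempty_mulEquiv_freeGroup_puncturedTorus (hne : i₀ ≠ i₁) (hι : ∀ i, i = i₀ ∨ i = i₁)
    (x₀ : ι → AddCircle (1 : ℝ)) (y : ({x₀}ᶜ : Set (ι → AddCircle (1 : ℝ)))) :
    Nonempty (_root_.FundamentalGroup ({x₀}ᶜ : Set (ι → AddCircle (1 : ℝ))) y ≃* FreeGroup (Fin 2)) := by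
  -- the base point `b = (x₀ i + ½)ᵢ`, on both edge circles
  set w₀ : ι → AddCircle (1 : ℝ) := fun i ↦ x₀ i + ((2⁻¹ : ℝ) : AddCircle (1 : ℝ)) with hw₀
  have hwi : ∀ i, w₀ i - x₀ i = ((2⁻¹ : ℝ) : AddCircle (1 : ℝ)) := fun i ↦ by simp [hw₀]
  have hwne : ∀ i, w₀ i ≠ x₀ i := fun i h ↦ half_ne_zero (by rw [← hwi i, h, sub_self])
  have hw₀ne : w₀ ≠ x₀ := fun h ↦ hwne i₀ (by rw [h])
  let b : ({x₀}ᶜ : Set (ι → AddCircle (1 : ℝ))) := ⟨w₀, hw₀ne⟩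
  -- the open cover by the two slit tori
  let U : Set ({x₀}ᶜ : Set (ι → AddCircle (1 : ℝ))) := {q | (q : ι → AddCircle (1 : ℝ)) i₁ ≠ x₀ i₁}
  let V : Set ({x₀}ᶜ : Set (ι → AddCircle (1 : ℝ))) := {q | (q : ι → AddCircle (1 : ℝ)) i₀ ≠ x₀ i₀}
  have hUo : IsOpen U :=
    isOpen_ne_fun ((continuous_apply i₁).comp continuous_subtype_val) continuous_const
  have hVo : IsOpen V :=
    isOpen_ne_fun ((continuous_apply i₀).comp continuous_subtype_val) continuous_const
  have hcov : U ∪ V = univ := by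
    refine eq_univ_of_forall fun q ↦ ?_
    by_contra h
    simp only [mem_union, not_or, mem_setOf_eq, not_not, U, V] at h
    apply q.2
    show (q : ι → AddCircle (1 : ℝ)) = x₀
    funext i
    rcases hι i with rfl | rfl
    · exact h.2
    · exact h.1
  have hbU : b ∈ U := hwne i₁
  have hbV : b ∈ V := hwne i₀
  -- images in `T` of the pieces
  have himU : (Subtype.val '' U) = {p : ι → AddCircle (1 : ℝ) | p i₁ ≠ x₀ i₁} := by
    ext p
    constructor
    · rintro ⟨q, hq, rfl⟩; exact hq
    · intro hp; exact ⟨⟨p, fun h ↦ hp (by rw [mem_singleton_iff.1 h])⟩, hp, rfl⟩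
  have himV : (Subtype.val '' V) = {p : ι → AddCircle (1 : ℝ) | p i₀ ≠ x₀ i₀} := by
    ext p
    constructor
    · rintro ⟨q, hq, rfl⟩; exact hq
    · intro hp; exact ⟨⟨p, fun h ↦ hp (by rw [mem_singleton_iff.1 h])⟩, hp, rfl⟩
  have himUV : (Subtype.val '' (U ∩ V)) = {p : ι → AddCircle (1 : ℝ) | ∀ i, p i ≠ x₀ i} := by
    ext p
    constructor
    · rintro ⟨q, ⟨hqU, hqV⟩, rfl⟩ i
      rcases hι i with rfl | rfl
      · exact hqV
      · exact hqU
    · intro hp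
      exact ⟨⟨p, fun h ↦ hp i₀ (by rw [mem_singleton_iff.1 h])⟩, ⟨hp i₁, hp i₀⟩, rfl⟩
  have hUpc : IsPathConnected U := by
    rw [Topology.IsInducing.subtypeVal.isPathConnected_iff, himU]
    exact isPathConnected_coordNe x₀ i₁
  have hVpc : IsPathConnected V := by
    rw [Topology.IsInducing.subtypeVal.isPathConnected_iff, himV]
    exact isPathConnected_coordNe x₀ i₀
  have hsc : IsSimplyConnected (U ∩ V) := by
    rw [← Topology.IsEmbedding.subtypeVal.isSimplyConnected_image, himUV]
    exact isSimplyConnected_forall_ne x₀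
  -- van Kampen, free-product form
  let E₀ := VanKampen.fundamentalGroupEquivCoprod hUo hVo hcov hbU hbV hUpc hVpc hsc
  -- the two factors are `F₁`
  have hι' : ∀ i, i = i₁ ∨ i = i₀ := fun i ↦ (hι i).symm
  -- `↥U ≃ₜ` the slit torus in `T`, based
  let hU : U ≃ₜ ({p : ι → AddCircle (1 : ℝ) | p i₁ ≠ x₀ i₁} : Set _) :=
    { toFun := fun q ↦ ⟨(q : ({x₀}ᶜ : Set (ι → AddCircle (1 : ℝ)))), q.2⟩
      invFun := fun p ↦ ⟨⟨p, fun h ↦ p.2 (by rw [mem_singleton_iff.1 h])⟩, p.2⟩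
      left_inv := fun q ↦ rfl
      right_inv := fun p ↦ rfl
      continuous_toFun := (continuous_subtype_val.comp continuous_subtype_val).subtype_mk _
      continuous_invFun := (continuous_subtype_val.subtype_mk _).subtype_mk _ }
  let hV : V ≃ₜ ({p : ι → AddCircle (1 : ℝ) | p i₀ ≠ x₀ i₀} : Set _) :=
    { toFun := fun q ↦ ⟨(q : ({x₀}ᶜ : Set (ι → AddCircle (1 : ℝ)))), q.2⟩
      invFun := fun p ↦ ⟨⟨p, fun h ↦ p.2 (by rw [mem_singleton_iff.1 h])⟩, p.2⟩
      left_inv := fun q ↦ rfl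
      right_inv := fun p ↦ rfl
      continuous_toFun := (continuous_subtype_val.comp continuous_subtype_val).subtype_mk _
      continuous_invFun := (continuous_subtype_val.subtype_mk _).subtype_mk _ }
  obtain ⟨fU⟩ := nonempty_mulEquiv_freeGroup_coordNe hne hι x₀ (w := w₀) (hwi i₁) (hwne i₁)
  obtain ⟨fV⟩ := nonempty_mulEquiv_freeGroup_coordNe (Ne.symm hne) hι' x₀ (w := w₀) (hwi i₀) (hwne i₀)
  let eU := (fundamentalGroupEquivOfHomeomorph hU (x := ⟨b, hbU⟩) (y := ⟨w₀, hwne i₁⟩) rfl).trans fU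
  let eV := (fundamentalGroupEquivOfHomeomorph hV (x := ⟨b, hbV⟩) (y := ⟨w₀, hwne i₀⟩) rfl).trans fV
  let E := E₀.trans ((MulEquiv.coprodCongr eU eV).trans
    ((freeGroupSumMulEquivCoprod (Fin 1) (Fin 1)).symm.trans
      (FreeGroup.freeGroupCongr finSumFinEquiv)))
  -- change of base point
  haveI := pathConnectedSpace_compl_singleton_torus hι x₀
  exact ⟨(_root_.FundamentalGroup.fundamentalGroupMulEquivOfPathConnected y b).trans E⟩

end PuncturedTorus

end Literature.AlgebraicTopology.FundamentalGroup

end
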